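import Literature.NumberTheory.Automorphic.UnitaryGroupTruncatedKernelClassMeasurable
import Literature.NumberTheory.Automorphic.UnitaryGroupTruncationFiniteSumTwo
import Mathlib.MeasureTheory.Constructions.Polish.Basic
import HarnessLib

/-!
# Arthur's truncated kernel `k^T` and its class parts `k^T_𝔬` on `U(J₂)` are Borel functions,
# on `G(𝔸_F)` and on `G(F)\G(𝔸_F)`
(Rogawski, *Automorphic Representations of Unitary Groups in Three Variables* (1990), §2.2 p. 13 — the rank-one
groups `U(3)`, `U(2)`, `U(2) × U(1)` of §7.3 p. 98; Arthur, *A trace formula for reductive groups I*, Duke Math. J.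
45 (1978), §8.)

Topic `NumberTheory/Automorphic`; namespace `Literature.NumberTheory.Automorphic.UnitaryGroup`. THEOREMS ONLY over
accepted tree modules: no definition, no named fact, no instance, no notation, no `sorry`. The `N = 2` sibling of the
`section Three` heads of ★ `UnitaryGroupTruncatedKernelMeasurable` (total kernel) and ★
`UnitaryGroupTruncatedKernelClassMeasurable` (class kernels), whose §§1–2 (`measurable_kernelBorel_diag`,
`measurable_kernelBorelTail`, `measurable_kernelClass_diag`, `measurable_kernelBorelTailClass`, …) are every-`N` and
USED; the only `N`-dependent input is the finiteness of the `δ`-sums, supplied at `N = 2` by ★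
`finite_setOf_lt_borelHeight_two` (`UnitaryGroupTruncationFiniteSumTwo`). H-SIDE copy of LAWS 1–5
(`H = U(Φ₂) × U(Φ₁)`; LEAD WORDs #123∕#124; census `CENSUS-LAWS-Hside.F0P3a-p03g6.md` §3 LAW 1∕LAW 3 — the measurability
letters every class row of the `N = 2` expansion consumes) of the T1 line `Cruxes/H413/Lines/F0_T1InnerFormTraceIdentity.lean`
(cell `pub/hodgecm-mathlib`, crux H413).

* §1 (total kernel) `measurable_pseudoEisenstein_kernelBorelTail_two`, **`measurable_truncatedKernel_two`**,
  **`measurable_quotFun_truncatedKernel_two`**, `aestronglyMeasurable_quotFun_truncatedKernel_two`.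
* §2 (class kernels, any class map `cl : G(F) → ι`) `finite_support_kernelBorelTailClass_translate_two`,
  `measurable_pseudoEisenstein_kernelBorelTailClass_two`, **`measurable_truncatedKernelClass_two`**,
  **`measurable_quotFun_truncatedKernelClass_two`** (under `IsConjInvariant cl`, `IsUnipotentInvariantOnBorel … cl`),
  `aestronglyMeasurable_quotFun_truncatedKernelClass_two`.

## References

* J. D. Rogawski, *Automorphic Representations of Unitary Groups in Three Variables*, Ann. of Math. Stud. 123 (1990),
  §2.2 (p. 13), §7.3 (p. 98) [Rogawski1990].
* J. Arthur, *A trace formula for reductive groups I*, Duke Math. J. 45 (1978), §8 [Arthur1978TraceFormulaI].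
-/

set_option autoImplicit false

noncomputable section

open MeasureTheory Measure NumberField IsDedekindDomain Matrix Topology
open scoped NNReal ENNReal MatrixGroups

namespace Literature.NumberTheory.Automorphic

namespace UnitaryGroup

variable {F E : Type} [Field F] [NumberField F] [Field E] [NumberField E] [Algebra F E]
  {c : E ≃ₐ[F] E} {ι : Type*}

/-- `𝔸_E` is Hausdorff (local copy of the standard three-line argument). [folklore] -/
private theorem t2Space_adeleRing_E₂ : T2Space (AdeleRing (𝓞 E) E) := by
  haveI : T2Space (FiniteAdeleRing (𝓞 E) E) := inferInstanceAs <| T2Space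
    (RestrictedProduct (fun w : HeightOneSpectrum (𝓞 E) => w.adicCompletion E)
      (fun w => (w.adicCompletionIntegers E : Set (w.adicCompletion E))) Filter.cofinite)
  haveI : T2Space (InfiniteAdeleRing E) :=
    inferInstanceAs <| T2Space ((w : InfinitePlace E) → w.Completion)
  exact inferInstanceAs <| T2Space (InfiniteAdeleRing E × FiniteAdeleRing (𝓞 E) E)

/-- `G(F)` is countable for `U(J₂)` (★ `countable_quotientSubgroup_quasiSplit` read through `A_G · G(F) = G(F)`).
[folklore] -/
private theorem countable_arithmeticSubgroup₂ : Countable (quasiSplit F E c 2).arithmeticSubgroup := by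
  rw [← quotientSubgroup_quasiSplit]; exact countable_quotientSubgroup_quasiSplit

section Two

variable [MeasurableSpace (quasiSplit F E c 2).Adelic] [BorelSpace (quasiSplit F E c 2).Adelic]
  [MeasurableSpace (adelicUnipotent F E c 2)] [BorelSpace (adelicUnipotent F E c 2)]

/-! ## §1 The total truncated kernel `k^T` on `U(J₂)` -/

/-- **The `δ`-sum `x ↦ Σ_δ 1_{H(δx) > T} K_B(δx, δx)` is measurable on `U(J₂)(𝔸_F)`** (`T > 0`): pointwise a finite
sum (★ `finite_support_kernelBorelTail_translate_two`), hence the `tsum` over the countable `B(F)\G(F)` of the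
measurable `x ↦ 1_{H > T} K_B(δ x, δ x)` (Mathlib `Measurable.tsum`). [cite: Rogawski1990, §2.2 (p. 13)] -/
theorem measurable_pseudoEisenstein_kernelBorelTail_two {f : (quasiSplit F E c 2).Adelic → ℂ}
    (hf : Continuous f) (hfs : HasCompactSupport f) (ν : Measure (adelicUnipotent F E c 2)) [SFinite ν]
    (𝓕 : Set (adelicUnipotent F E c 2)) {T : ℝ≥0} (hT : 0 < T) :
    Measurable fun x : (quasiSplit F E c 2).Adelic => pseudoEisenstein (kernelBorelTail ν 𝓕 T f) x := by
  haveI : Countable ↥(quasiSplit F E c 2).arithmeticSubgroup := countable_arithmeticSubgroup₂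
  haveI : Countable (Quotient (QuotientGroup.rightRel (arithmeticBorel F E c 2))) :=
    Quotient.countable
  have heq : (fun x : (quasiSplit F E c 2).Adelic => pseudoEisenstein (kernelBorelTail ν 𝓕 T f) x) =
      fun x => ∑' q : Quotient (QuotientGroup.rightRel (arithmeticBorel F E c 2)),
        kernelBorelTail ν 𝓕 T f
          (((q.out : (quasiSplit F E c 2).arithmeticSubgroup) : (quasiSplit F E c 2).Adelic) * x) := by
    funext x
    rw [pseudoEisenstein_def]
    exact (tsum_eq_finsum (finite_support_kernelBorelTail_translate_two ν 𝓕 hT f x)).symm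
  rw [heq]
  refine Measurable.tsum fun q => ?_
  exact (measurable_kernelBorelTail hf hfs ν 𝓕 T).comp (measurable_const_mul _)

/-- **Arthur's truncated kernel `k^T` is Borel measurable on `U(J₂)(𝔸_F)`** for `f ∈ C_c`, `T > 0`, every
s-finite measure `ν` and every set `𝓕` (★ `continuous_kernel` for the diagonal `K(x, x)`, §1 for the `δ`-sum).
[cite: Rogawski1990, §2.2 (p. 13)] -/
theorem measurable_truncatedKernel_two {f : (quasiSplit F E c 2).Adelic → ℂ} (hf : Continuous f)
    (hfs : HasCompactSupport f) (ν : Measure (adelicUnipotent F E c 2)) [SFinite ν]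
    (𝓕 : Set (adelicUnipotent F E c 2)) {T : ℝ≥0} (hT : 0 < T) :
    Measurable (truncatedKernel ν 𝓕 T f) := by
  have h1 : Measurable fun x : (quasiSplit F E c 2).Adelic => kernel f x x :=
    ((continuous_kernel hf hfs).comp (continuous_id.prodMk continuous_id)).measurable
  have h2 := measurable_pseudoEisenstein_kernelBorelTail_two hf hfs ν 𝓕 hT
  have heq : truncatedKernel ν 𝓕 T f = fun x => kernel f x x - pseudoEisenstein (kernelBorelTail ν 𝓕 T f) x :=
    funext fun x => truncatedKernel_def ν 𝓕 T f x
  rw [heq]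
  exact h1.sub h2

/-- **The descended truncated kernel `[g] ↦ k^T(g⁻¹)` is Borel on the automorphic quotient `G(𝔸_F) ⧸ G(F)` of
`U(J₂)`**: Borel measurability descends along the quotient by the CLOSED subgroup `A_G · G(F) = G(F)`
(★ `measurable_quotient_iff`, ★ `isClosed_quotientSubgroup_quasiSplit`), and `quotFun k^T ∘ π = k^T ∘ inv`
(★ `quotFun_truncatedKernel_toAutomorphicQuotient'`) is measurable. [cite: Rogawski1990, §2.2 (p. 13)] -/
theorem measurable_quotFun_truncatedKernel_two {f : (quasiSplit F E c 2).Adelic → ℂ} (hf : Continuous f)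
    (hfs : HasCompactSupport f) (ν : Measure (adelicUnipotent F E c 2)) [ν.IsHaarMeasure]
    {𝓕 : Set (adelicUnipotent F E c 2)} (h𝓕 : IsFundamentalDomain (rationalUnipotent F E c 2) 𝓕 ν)
    {T : ℝ≥0} (hT : 0 < T) :
    Measurable ((quasiSplit F E c 2).quotFun (truncatedKernel ν 𝓕 T f)) := by
  haveI := secondCountableTopology_adeleRing E
  haveI := locallyCompactSpace_adeleRing' E
  haveI : T2Space (quasiSplit F E c 2).Adelic :=
    inferInstanceAs (T2Space (adelic F E c 2 ((StdForm.antidiagonal 2).over E)))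
  haveI : LocallyCompactSpace (quasiSplit F E c 2).Adelic :=
    inferInstanceAs (LocallyCompactSpace (adelic F E c 2 ((StdForm.antidiagonal 2).over E)))
  haveI : SecondCountableTopology (quasiSplit F E c 2).Adelic :=
    inferInstanceAs (SecondCountableTopology (adelic F E c 2 ((StdForm.antidiagonal 2).over E)))
  -- `N(𝔸_F)` is second countable locally compact, so `ν` is s-finite
  haveI : T2Space (AdeleRing (𝓞 E) E) := t2Space_adeleRing_E₂ (E := E)
  haveI : LocallyCompactSpace (adelicUnipotent F E c 2) := by
    have hcl : IsClosed ((adelicUnipotent F E c 2 : Set (quasiSplit F E c 2).Adelic)) := by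
      change IsClosed (⇑(adelicVal F E c 2 ((StdForm.antidiagonal 2).over E)) ⁻¹'
        ((upperUnitriangular (Fin 2) (AdeleRing (𝓞 E) E) : Subgroup (GL (Fin 2) (AdeleRing (𝓞 E) E))) :
          Set (GL (Fin 2) (AdeleRing (𝓞 E) E))))
      exact (isClosed_upperUnitriangular (R := AdeleRing (𝓞 E) E)).preimage continuous_subtype_val
    exact hcl.locallyCompactSpace
  haveI : SecondCountableTopology (adelicUnipotent F E c 2) :=
    TopologicalSpace.Subtype.secondCountableTopology _
  letI : MeasurableSpace ((quasiSplit F E c 2).Adelic ⧸ (quasiSplit F E c 2).quotientSubgroup) :=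
    (quasiSplit F E c 2).instMeasurableSpaceAutomorphicQuotient
  haveI : BorelSpace ((quasiSplit F E c 2).Adelic ⧸ (quasiSplit F E c 2).quotientSubgroup) :=
    (quasiSplit F E c 2).instBorelSpaceAutomorphicQuotient
  have hmeas := (Literature.MeasureTheory.Group.measurable_quotient_iff
    (G := (quasiSplit F E c 2).Adelic) (H := (quasiSplit F E c 2).quotientSubgroup)
    isClosed_quotientSubgroup_quasiSplit
    (F := (quasiSplit F E c 2).quotFun (truncatedKernel ν 𝓕 T f))).2
  have heq : (quasiSplit F E c 2).quotFun (truncatedKernel ν 𝓕 T f) ∘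
      (QuotientGroup.mk : (quasiSplit F E c 2).Adelic → (quasiSplit F E c 2).Adelic ⧸ (quasiSplit F E c 2).quotientSubgroup) =
        fun g => truncatedKernel ν 𝓕 T f g⁻¹ := by
    funext g
    exact quotFun_truncatedKernel_toAutomorphicQuotient' ν h𝓕 T f g
  exact hmeas (heq ▸ (measurable_truncatedKernel_two hf hfs ν 𝓕 hT).comp measurable_inv)

/-- Hence the integrand of `J^T(f)` on `U(J₂)` is a.e.-strongly measurable for every measure `μ` on the automorphic
quotient (the measurability half of «`k^T` is integrable»; `ℂ` is second countable). [cite: Rogawski1990, §2.2 (p. 13)] -/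
theorem aestronglyMeasurable_quotFun_truncatedKernel_two {f : (quasiSplit F E c 2).Adelic → ℂ}
    (hf : Continuous f) (hfs : HasCompactSupport f) (ν : Measure (adelicUnipotent F E c 2))
    [ν.IsHaarMeasure] {𝓕 : Set (adelicUnipotent F E c 2)}
    (h𝓕 : IsFundamentalDomain (rationalUnipotent F E c 2) 𝓕 ν) {T : ℝ≥0} (hT : 0 < T)
    (μ : Measure (quasiSplit F E c 2).automorphicQuotient) :
    AEStronglyMeasurable ((quasiSplit F E c 2).quotFun (truncatedKernel ν 𝓕 T f)) μ :=
  (measurable_quotFun_truncatedKernel_two hf hfs ν h𝓕 hT).aestronglyMeasurable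

/-! ## §2 The class truncated kernels `k^T_𝔬` on `U(J₂)` -/

omit [MeasurableSpace (quasiSplit F E c 2).Adelic] [BorelSpace (quasiSplit F E c 2).Adelic]
  [BorelSpace (adelicUnipotent F E c 2)] in
/-- **The `δ`-sum of `k^T_𝔬` is a finite sum on `U(J₂)`** (`T > 0`): only finitely many classes `B(F) δ` have
`H(δ x) > T` (★ `finite_setOf_lt_borelHeight_two`), and the class tail vanishes below the cut-off.
[cite: Rogawski1990, §2.2 (p. 13)] -/
theorem finite_support_kernelBorelTailClass_translate_two (ν : Measure (adelicUnipotent F E c 2))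
    (𝓕 : Set (adelicUnipotent F E c 2)) {T : ℝ≥0} (hT : 0 < T)
    (cl : (quasiSplit F E c 2).arithmeticSubgroup → ι) (i : ι) (f : (quasiSplit F E c 2).Adelic → ℂ)
    (x : (quasiSplit F E c 2).Adelic) :
    (Function.support fun q : Quotient (QuotientGroup.rightRel (arithmeticBorel F E c 2)) =>
      kernelBorelTailClass ν 𝓕 T cl i f
        (((q.out : (quasiSplit F E c 2).arithmeticSubgroup) : (quasiSplit F E c 2).Adelic) * x)).Finite := by
  refine (finite_setOf_lt_borelHeight_two x hT).subset fun q hq => ?_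
  by_contra hlt
  exact hq (kernelBorelTailClass_of_not_lt cl i f hlt)

/-- **The `δ`-sum `x ↦ Σ_δ 1_{H(δx) > T} K_{B,𝔬}(δx, δx)` is measurable on `U(J₂)(𝔸_F)`** (`T > 0`): pointwise a
finite sum, hence the `tsum` over the countable `B(F)\G(F)` of measurable translates (Mathlib `Measurable.tsum`).
[cite: Rogawski1990, §2.2 (p. 13)] -/
theorem measurable_pseudoEisenstein_kernelBorelTailClass_two {f : (quasiSplit F E c 2).Adelic → ℂ}
    (hf : Continuous f) (ν : Measure (adelicUnipotent F E c 2)) [SFinite ν]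
    (𝓕 : Set (adelicUnipotent F E c 2)) {T : ℝ≥0} (hT : 0 < T)
    (cl : (quasiSplit F E c 2).arithmeticSubgroup → ι) (i : ι) :
    Measurable fun x : (quasiSplit F E c 2).Adelic =>
      pseudoEisenstein (kernelBorelTailClass ν 𝓕 T cl i f) x := by
  haveI : Countable ↥(quasiSplit F E c 2).arithmeticSubgroup := countable_arithmeticSubgroup₂
  haveI : Countable (Quotient (QuotientGroup.rightRel (arithmeticBorel F E c 2))) :=
    Quotient.countable
  have heq : (fun x : (quasiSplit F E c 2).Adelic => pseudoEisenstein (kernelBorelTailClass ν 𝓕 T cl i f) x) =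
      fun x => ∑' q : Quotient (QuotientGroup.rightRel (arithmeticBorel F E c 2)),
        kernelBorelTailClass ν 𝓕 T cl i f
          (((q.out : (quasiSplit F E c 2).arithmeticSubgroup) : (quasiSplit F E c 2).Adelic) * x) := by
    funext x
    rw [pseudoEisenstein_def]
    exact (tsum_eq_finsum (finite_support_kernelBorelTailClass_translate_two ν 𝓕 hT cl i f x)).symm
  rw [heq]
  refine Measurable.tsum fun q => ?_
  exact (measurable_kernelBorelTailClass hf ν 𝓕 T cl i).comp (measurable_const_mul _)

/-- **The class truncated kernel `k^T_𝔬` is Borel measurable on `U(J₂)(𝔸_F)`** for continuous `f`, `T > 0`, every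
s-finite `ν`, every `𝓕`, every class map and class (★ `measurable_kernelClass_diag` for the diagonal `K_𝔬(x, x)`,
§2 for the `δ`-sum). [cite: Rogawski1990, §2.2 (p. 13)] -/
theorem measurable_truncatedKernelClass_two {f : (quasiSplit F E c 2).Adelic → ℂ} (hf : Continuous f)
    (ν : Measure (adelicUnipotent F E c 2)) [SFinite ν] (𝓕 : Set (adelicUnipotent F E c 2))
    {T : ℝ≥0} (hT : 0 < T) (cl : (quasiSplit F E c 2).arithmeticSubgroup → ι) (i : ι) :
    Measurable (truncatedKernelClass ν 𝓕 T cl i f) := by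
  have h1 := measurable_kernelClass_diag cl i hf
  have h2 := measurable_pseudoEisenstein_kernelBorelTailClass_two hf ν 𝓕 hT cl i
  have heq : truncatedKernelClass ν 𝓕 T cl i f =
      fun x => kernelClass cl i f x x - pseudoEisenstein (kernelBorelTailClass ν 𝓕 T cl i f) x :=
    funext fun x => truncatedKernelClass_def ν 𝓕 T cl i f x
  rw [heq]
  exact h1.sub h2

/-- **The descended class truncated kernel `[g] ↦ k^T_𝔬(g⁻¹)` is Borel on the automorphic quotient
`G(𝔸_F) ⧸ G(F)` of `U(J₂)`** under Rogawski's two partition axioms (`IsConjInvariant`, `IsUnipotentInvariantOnBorel`),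
for a Haar measure `ν` of `N(𝔸_F)` and a fundamental domain `𝓕` of `N(F)` (the honest descent ★
`quotFun_truncatedKernelClass_toAutomorphicQuotient'`): Borel measurability descends along the quotient by the closed
`G(F)` (★ `measurable_quotient_iff`, ★ `isClosed_quotientSubgroup_quasiSplit`). [cite: Rogawski1990, §2.2 (p. 13)] -/
theorem measurable_quotFun_truncatedKernelClass_two {cl : (quasiSplit F E c 2).arithmeticSubgroup → ι}
    (hcl : IsConjInvariant cl) (hclN : IsUnipotentInvariantOnBorel F E c 2 cl)
    {f : (quasiSplit F E c 2).Adelic → ℂ} (hf : Continuous f)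
    (ν : Measure (adelicUnipotent F E c 2)) [ν.IsHaarMeasure]
    {𝓕 : Set (adelicUnipotent F E c 2)} (h𝓕 : IsFundamentalDomain (rationalUnipotent F E c 2) 𝓕 ν)
    {T : ℝ≥0} (hT : 0 < T) (i : ι) :
    Measurable ((quasiSplit F E c 2).quotFun (truncatedKernelClass ν 𝓕 T cl i f)) := by
  haveI := secondCountableTopology_adeleRing E
  haveI := locallyCompactSpace_adeleRing' E
  haveI : T2Space (quasiSplit F E c 2).Adelic :=
    inferInstanceAs (T2Space (adelic F E c 2 ((StdForm.antidiagonal 2).over E)))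
  haveI : LocallyCompactSpace (quasiSplit F E c 2).Adelic :=
    inferInstanceAs (LocallyCompactSpace (adelic F E c 2 ((StdForm.antidiagonal 2).over E)))
  haveI : SecondCountableTopology (quasiSplit F E c 2).Adelic :=
    inferInstanceAs (SecondCountableTopology (adelic F E c 2 ((StdForm.antidiagonal 2).over E)))
  -- `N(𝔸_F)` is second countable locally compact, so the Haar measure `ν` is s-finite
  haveI : T2Space (AdeleRing (𝓞 E) E) := t2Space_adeleRing_E₂ (E := E)
  haveI : LocallyCompactSpace (adelicUnipotent F E c 2) := by
    have hcl' : IsClosed ((adelicUnipotent F E c 2 : Set (quasiSplit F E c 2).Adelic)) := by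
      change IsClosed (⇑(adelicVal F E c 2 ((StdForm.antidiagonal 2).over E)) ⁻¹'
        ((upperUnitriangular (Fin 2) (AdeleRing (𝓞 E) E) : Subgroup (GL (Fin 2) (AdeleRing (𝓞 E) E))) :
          Set (GL (Fin 2) (AdeleRing (𝓞 E) E))))
      exact (isClosed_upperUnitriangular (R := AdeleRing (𝓞 E) E)).preimage continuous_subtype_val
    exact hcl'.locallyCompactSpace
  haveI : SecondCountableTopology (adelicUnipotent F E c 2) :=
    TopologicalSpace.Subtype.secondCountableTopology _
  letI : MeasurableSpace ((quasiSplit F E c 2).Adelic ⧸ (quasiSplit F E c 2).quotientSubgroup) :=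
    (quasiSplit F E c 2).instMeasurableSpaceAutomorphicQuotient
  haveI : BorelSpace ((quasiSplit F E c 2).Adelic ⧸ (quasiSplit F E c 2).quotientSubgroup) :=
    (quasiSplit F E c 2).instBorelSpaceAutomorphicQuotient
  have hmeas := (Literature.MeasureTheory.Group.measurable_quotient_iff
    (G := (quasiSplit F E c 2).Adelic) (H := (quasiSplit F E c 2).quotientSubgroup)
    isClosed_quotientSubgroup_quasiSplit
    (F := (quasiSplit F E c 2).quotFun (truncatedKernelClass ν 𝓕 T cl i f))).2
  have heq : (quasiSplit F E c 2).quotFun (truncatedKernelClass ν 𝓕 T cl i f) ∘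
      (QuotientGroup.mk : (quasiSplit F E c 2).Adelic →
        (quasiSplit F E c 2).Adelic ⧸ (quasiSplit F E c 2).quotientSubgroup) =
        fun g => truncatedKernelClass ν 𝓕 T cl i f g⁻¹ := by
    funext g
    exact quotFun_truncatedKernelClass_toAutomorphicQuotient' hcl hclN ν h𝓕 T i f g
  exact hmeas (heq ▸ (measurable_truncatedKernelClass_two hf ν 𝓕 hT cl i).comp measurable_inv)

/-- Hence the integrand of `J^T_𝔬(f)` on `U(J₂)` is a.e.-strongly measurable for every measure `μ` on the automorphic
quotient (the measurability half of «`k^T_𝔬` is integrable»; `ℂ` is second countable). [cite: Rogawski1990, §2.2 (p. 13)] -/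
theorem aestronglyMeasurable_quotFun_truncatedKernelClass_two
    {cl : (quasiSplit F E c 2).arithmeticSubgroup → ι}
    (hcl : IsConjInvariant cl) (hclN : IsUnipotentInvariantOnBorel F E c 2 cl)
    {f : (quasiSplit F E c 2).Adelic → ℂ} (hf : Continuous f)
    (ν : Measure (adelicUnipotent F E c 2)) [ν.IsHaarMeasure]
    {𝓕 : Set (adelicUnipotent F E c 2)} (h𝓕 : IsFundamentalDomain (rationalUnipotent F E c 2) 𝓕 ν)
    {T : ℝ≥0} (hT : 0 < T) (i : ι) (μ : Measure (quasiSplit F E c 2).automorphicQuotient) :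
    AEStronglyMeasurable ((quasiSplit F E c 2).quotFun (truncatedKernelClass ν 𝓕 T cl i f)) μ :=
  (measurable_quotFun_truncatedKernelClass_two hcl hclN hf ν h𝓕 hT i).aestronglyMeasurable

end Two

end UnitaryGroup

end Literature.NumberTheory.Automorphic
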